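/-
Copyright: the b2b-balaban T⁴-continuum CRUX team, row NE7b leaf lineage `t4-ne7b-formalise-leaf-05` (gen 155). Project licence.
-/
import Mathlib.Algebra.BigOperators.Group.Finset.Basic
import Summits.QuantumFields.BalabanUV.T4Continuum.Spine.NE7b.NonAbelianStokesDisc

/-!
# (NAS) part 3½ — THE COORDINATE RECTANGLE AS A PLAQUETTE SCRIPT: the `n × K` rectangle word `rectWord κ μ n K` of `NonAbelianStokesBound` is
# BUILT by a script of `NonAbelianStokesDisc` inserting exactly the `n·K` plaquette contours `∂p_{κμ}(x + i e_κ + j e_μ)`, each once, plus backtracks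
# and cancellations — the «combinatorial half» that `NonAbelianStokesDisc` left «to the user of a shape» (row NE7b, node U5c; companion of leaf-01 g28's
# `NonAbelianStokesBound ∕ Disc` and of this lineage's `LinearisedLatticeStokesDisc`)

Cell `pub-balaban`, sub-cell `t4`, spine estimate NE7b (`T4WeightBudget.RelWeightBound`; the cell's OWN estimate — NOT PRINTED in [Bałaban 1983–89], NOT PROVED).
Crux-route work under `Spine/NE7b/` by a row leaf; [folklore] list bookkeeping on lattice words; NOTHING of Bałaban's is named, asserted or valued; no
`T4Continuum/Support` leaf typed; FOUR data definitions (scripts: `rowBase`, `colMoves`, `rowCancels`, `rectScript` — list-valued, no `Prop`-valued definition);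
zero `sorry`.  Imports: Mathlib finite sums + leaf-01's BUILT `Spine/NE7b/NonAbelianStokesDisc` (`Move`, `Move.apply`, `build`, `loops`, `glued`,
`dist1_hol_build_le_sum_plaquettes` BY NAME; through it `NonAbelianStokesBound.rectWord`).

WHY (located).  `NonAbelianStokesDisc` (p258845) proves (NAS) `dist1 V(build ms) ≤ Σ_{glued} dist1 V(σ)` for every disc PRESENTED BY A SCRIPT and says: «Writing the
script of a given disc shape — the non-abelian Stokes THEOREM's combinatorial half — is list bookkeeping left to the user of a shape (the coordinate rectangle
was done directly in part 1 by the stack-of-ladders recursion)»; its sanity check `build_rect21` scripts the `2 × 1` rectangle by hand.  THIS FILE writes the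
script of EVERY coordinate rectangle and proves it builds `rectWord κ μ n K` LETTER FOR LETTER (not just up to holonomy), with the glued loops = the `n·K`
plaquettes at their corners.  Consequences BY NAME: part 3's (NAS) specialises to part 1's rectangle inequality (same plaquette sum, summed column by
column — `example`), and this lineage's `LinearisedLatticeStokesDisc` (flat exactness ∕ curvature defect for scripts) applies to rectangles with the
COMB transports `U(κ^i · κ · μ^j · κ⁻¹)` (a second flat formula next to `LinearisedLatticeStokesRectangle`'s row transports; junction cert NOT-TO-FILE
until that file's olean exists).

THE SCRIPT (moves listed head = applied LAST; `x` the base point; `κ⁺ = (κ, true)`, `κ⁻ = (κ, false)`).  `R_{0,K} = μ^K μ̄^K` by `K` nested backtracks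
(`rowBase`).  From `R_{n,K} = κ^n μ^K κ̄^n μ̄^K`: (1) a backtrack `κ⁺κ⁻` at position `n` gives `κ^n · κ⁺κ⁻ · μ^K κ̄^n μ̄^K`; (2) the COLUMN PHASE
(`colMoves`): for `j = 0, …, K−1`, insert `∂p_{κμ}` (= `κ⁺μ⁺κ⁻μ⁻`) at position `n + j + 2` — after the prefix `κ^n κ⁺ μ^j κ⁻`, i.e. at the corner
`x + n e_κ + j e_μ` — and cancel the backtrack `κ⁻κ⁺` at position `n + j + 1`; this grows the inserted column `κ⁺ μ^j κ⁻ μ̄^j ↦ κ⁺ μ^{j+1} κ⁻ μ̄^{j+1}`;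
(3) the ROW PHASE (`rowCancels`): the word is now `κ^{n+1} μ^K κ⁻ · μ̄^K μ^K · κ̄^n μ̄^K`; cancel the `K` nested backtracks `μ̄ μ` at positions
`n+2K+1, n+2K, …, n+K+2` to reach `R_{n+1,K} = κ^{n+1} μ^K κ̄^{n+1} μ̄^K`.

WHAT IS PROVED ([folklore]):
* §0 THREE POSITIONAL LEMMAS for leaf-01's moves on a word `A ++ B` with `|A| =` the position: `apply_backtrack_of_length`, `apply_loop_of_length`,
  `apply_cancel_of_length` (the cancel FIRES on `A ++ l · l⁻¹ ++ C`).
* §1 DATA: `rowBase μ K`, `colMoves κ μ n j`, `rowCancels μ base t m`, `rectScript κ μ K n`.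
* §2 BUILDS: `build_rowBase` (`μ^K μ̄^K`), `build_colMoves` (column phase), `build_rowCancels` (row phase), **`build_rectScript_replicate`**
  (`build (rectScript κ μ K n) = κ^n μ^K κ̄^n μ̄^K`) and **`build_rectScript`** (`= rectWord κ μ n K`).
* §3 LOOPS ∕ GLUED: `loops_rectScript` (every inserted word IS `plaqWord κ μ`), `glued_rectScript_zero ∕ _succ` (the new column's `K` plaquettes at
  `x + n e_κ + j e_μ`, `j = K−1, …, 0`, in front of the old list), **`sum_glued_rectScript`** (`Σ_{glued} f = Σ_{i<n} Σ_{j<K} f(x + i e_κ + j e_μ, ∂p)`).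
* §4 (NAS) FOR THE RECTANGLE FROM PART 3 BY NAME: **`dist1_hol_rectWord_le_sum_glued`** (`dist1 V(∂R_{n,K}) ≤ Σ_{glued} dist1 V(∂p)` =
  `dist1_hol_build_le_sum_plaquettes` ∘ `build_rectScript`) and the column-by-column Finset form **`dist1_hol_rectWord_le_sum_cols`**
  (`≤ Σ_{i<n} Σ_{j<K} dist1 V(∂p(x + ie_κ + je_μ))`; part 1's `dist1_hol_rectWord_le_sum` is the same sum row by row — `example` by `Finset.sum_comm`).
* §5 SANITY: `rectScript κ μ 1 2` builds leaf-01's `rectWord κ μ 2 1` (`example`), and the `1 × 1` script builds `plaqWord κ μ`.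

NOT HERE (honest): other disc shapes (L-shapes, collars, block-union boundaries — each its own bookkeeping); the pair-level ∕ linearised reading (a
NOT-TO-FILE junction with `LinearisedLatticeStokesDisc` until its olean exists); which rectangles are Bałaban's ((A3) ∕ (A1c), NC-NE7b-α UNRULED).
BY-NAME EFFECT ON THE WALL: NONE.  NE7b NOT PRINTED ∕ NOT PROVED; spine PROVED 0∕9; rung (B)+1 on a FINITE torus — NOT infinite volume, NOT the mass
gap, NOT Clay.  HONEST DEPENDENCY: continuum YM on T⁴ ⇐ BetaPertH ∧ nine spine estimates (0/9 proved); BetaPertH ⇐ (D1) ∧ (D4) ∧ CAP+tail; G-an2-4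
gates asym, D1 and NE2/3/4.
-/

set_option autoImplicit false

open scoped BigOperators

namespace Summit.QuantumFields.BalabanUV.T4Continuum.NE7b.NonAbelianStokesRectScript

open Literature.MathematicalPhysics.QuantumFieldTheory.Balaban1983to89 (GaugeGroup dist1)
open Literature.MathematicalPhysics.QuantumFieldTheory.Balaban1983to89.B7Prop1Explicit
  (Site Letter e disp disp_append disp_replicate hol plaqWord seg seg_natCast seg_neg_natCast revWord revWord_seg)
open NonAbelianStokesBound (rectWord)
open NonAbelianStokesDisc

variable {d : ℕ}

/-! ## §0 Positional lemmas for the three moves -/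

section Positional

/-- A backtrack inserted at position `|A|` of `A ++ B` lands between `A` and `B`. [folklore] -/
theorem apply_backtrack_of_length {n : ℕ} (l : Letter d) (A B : List (Letter d)) (h : A.length = n) :
    (Move.backtrack n l).apply (A ++ B) = A ++ l :: l.rev :: B := by
  show (A ++ B).take n ++ l :: l.rev :: (A ++ B).drop n = _
  rw [List.take_left' h, List.drop_left' h]

/-- A word inserted at position `|A|` of `A ++ B` lands between `A` and `B`. [folklore] -/
theorem apply_loop_of_length {n : ℕ} (σ A B : List (Letter d)) (h : A.length = n) :
    (Move.loop n σ).apply (A ++ B) = A ++ σ ++ B := by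
  show (A ++ B).take n ++ σ ++ (A ++ B).drop n = _
  rw [List.take_left' h, List.drop_left' h]

/-- The cancel move at position `|A|` FIRES on `A ++ l · l⁻¹ ++ C` and removes the backtrack. [folklore] -/
theorem apply_cancel_of_length {n : ℕ} (l : Letter d) (A C : List (Letter d)) (h : A.length = n) :
    (Move.cancel n l).apply (A ++ l :: l.rev :: C) = A ++ C := by
  have hd : (A ++ l :: l.rev :: C).drop n = l :: l.rev :: C := List.drop_left' h
  have h2 : (A ++ [l, l.rev]).length = n + 2 := by simp [h]
  have ht : (l :: l.rev :: C).take 2 = [l, l.rev] := rfl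
  show (if ((A ++ l :: l.rev :: C).drop n).take 2 = [l, l.rev] then
      (A ++ l :: l.rev :: C).take n ++ (A ++ l :: l.rev :: C).drop (n + 2) else A ++ l :: l.rev :: C) = A ++ C
  rw [hd, if_pos ht, List.take_left' h, show A ++ l :: l.rev :: C = (A ++ [l, l.rev]) ++ C by simp, List.drop_left' h2]

end Positional

/-! ## §1 The scripts (DATA) -/

section Scripts

/-- DATA.  `K` nested backtracks `μ⁺μ⁻`: builds `μ^K μ̄^K` (the degenerate rectangle `R_{0,K}`). -/
def rowBase (μ : Fin d) : ℕ → List (Move d)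
  | 0 => []
  | j + 1 => Move.backtrack j (μ, true) :: rowBase μ j

/-- DATA.  The COLUMN PHASE at `x`-offset `n`: for `j = 0, …, K−1` (head = `j = K−1`, applied last) insert `∂p_{κμ}` at position `n + j + 2` and cancel
the backtrack `κ⁻κ⁺` at position `n + j + 1`. -/
def colMoves (κ μ : Fin d) (n : ℕ) : ℕ → List (Move d)
  | 0 => []
  | j + 1 => Move.cancel (n + j + 1) (κ, false) :: Move.loop (n + j + 2) (plaqWord κ μ) :: colMoves κ μ n j

/-- DATA.  The ROW PHASE: `m` cancel moves of `μ⁻μ⁺` at positions `base + t, base + t + 1, …, base + t + m − 1` (head = position `base + t`, applied last). -/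
def rowCancels (μ : Fin d) (base : ℕ) : ℕ → ℕ → List (Move d)
  | _, 0 => []
  | t, m + 1 => Move.cancel (base + t) (μ, false) :: rowCancels μ base (t + 1) m

/-- DATA.  THE RECTANGLE SCRIPT: `rectScript κ μ K n` builds `rectWord κ μ n K` (§2) from `n·K` plaquette insertions (§3). -/
def rectScript (κ μ : Fin d) (K : ℕ) : ℕ → List (Move d)
  | 0 => rowBase μ K
  | n + 1 => rowCancels μ (n + K + 2) 0 K ++ (colMoves κ μ n K ++ (Move.backtrack n (κ, true) :: rectScript κ μ K n))

end Scripts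

/-! ## §2 What the scripts build -/

section Builds

/-- `rowBase μ K` builds `μ^K μ̄^K`. [folklore] -/
theorem build_rowBase (μ : Fin d) : ∀ K : ℕ,
    build (rowBase μ K) = List.replicate K ((μ, true) : Letter d) ++ List.replicate K (μ, false)
  | 0 => rfl
  | K + 1 => by
    rw [rowBase, build, build_rowBase μ K, apply_backtrack_of_length _ _ _ (List.length_replicate ..),
      List.replicate_succ' (n := K), List.replicate_succ (n := K), List.append_assoc]
    rfl

/-- THE COLUMN PHASE: if `rest` builds `pre ++ κ⁺ μ^0 κ⁻ μ̄^0 ++ suf` with `|pre| = n`, then `colMoves κ μ n j ++ rest` builds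
`pre ++ κ⁺ μ^j κ⁻ μ̄^j ++ suf`. [folklore] -/
theorem build_colMoves (κ μ : Fin d) {n : ℕ} (pre suf : List (Letter d)) (hpre : pre.length = n) (rest : List (Move d))
    (hrest : build rest = pre ++ ((κ, true) :: (κ, false) :: suf)) : ∀ j : ℕ,
    build (colMoves κ μ n j ++ rest) =
      pre ++ ((κ, true) :: (List.replicate j ((μ, true) : Letter d) ++ (κ, false) :: (List.replicate j ((μ, false) : Letter d) ++ suf)))
  | 0 => by simpa [colMoves] using hrest
  | j + 1 => by
    have ih := build_colMoves κ μ pre suf hpre rest hrest j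
    have hA : (pre ++ ((κ, true) :: (List.replicate j ((μ, true) : Letter d) ++ [(κ, false)]))).length = n + j + 2 := by
      simp [hpre]; omega
    have hA' : (pre ++ ((κ, true) :: List.replicate j ((μ, true) : Letter d))).length = n + j + 1 := by
      simp [hpre]; omega
    rw [colMoves, List.cons_append, List.cons_append, build, build, ih,
      show pre ++ ((κ, true) :: (List.replicate j ((μ, true) : Letter d) ++ (κ, false) :: (List.replicate j ((μ, false) : Letter d) ++ suf)))
        = (pre ++ ((κ, true) :: (List.replicate j ((μ, true) : Letter d) ++ [(κ, false)]))) ++ (List.replicate j ((μ, false) : Letter d) ++ suf) by simp,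
      apply_loop_of_length _ _ _ hA,
      show pre ++ (κ, true) :: (List.replicate j (μ, true) ++ [(κ, false)]) ++ plaqWord κ μ ++ (List.replicate j ((μ, false) : Letter d) ++ suf)
        = (pre ++ ((κ, true) :: List.replicate j ((μ, true) : Letter d))) ++
            (κ, false) :: Letter.rev ((κ, false) : Letter d) :: ((μ, true) :: (κ, false) :: (μ, false) :: (List.replicate j ((μ, false) : Letter d) ++ suf)) by
          simp [plaqWord],
      apply_cancel_of_length _ _ _ hA', List.replicate_succ' (n := j), List.replicate_succ (n := j)]
    simp

/-- THE ROW PHASE: if `rest` builds `pre ++ μ̄^{t+m} μ^{t+m} ++ suf` with `|pre| = base`, then `rowCancels μ base t m ++ rest` builds `pre ++ μ̄^t μ^t ++ suf`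
(the `m` innermost of the `t + m` nested backtracks are cancelled, deepest first). [folklore] -/
theorem build_rowCancels (μ : Fin d) {base : ℕ} (pre suf : List (Letter d)) (hpre : pre.length = base) (rest : List (Move d)) :
    ∀ (m t : ℕ), build rest = pre ++ (List.replicate (t + m) ((μ, false) : Letter d) ++ (List.replicate (t + m) ((μ, true) : Letter d) ++ suf)) →
      build (rowCancels μ base t m ++ rest) = pre ++ (List.replicate t ((μ, false) : Letter d) ++ (List.replicate t ((μ, true) : Letter d) ++ suf))
  | 0, t, hrest => by simpa [rowCancels] using hrest
  | m + 1, t, hrest => by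
    have ih := build_rowCancels μ pre suf hpre rest m (t + 1) (by rw [hrest]; congr 1; rw [show t + 1 + m = t + (m + 1) by omega])
    have hA : (pre ++ List.replicate t ((μ, false) : Letter d)).length = base + t := by simp [hpre]
    rw [rowCancels, List.cons_append, build, ih,
      show pre ++ (List.replicate (t + 1) ((μ, false) : Letter d) ++ (List.replicate (t + 1) ((μ, true) : Letter d) ++ suf))
        = (pre ++ List.replicate t ((μ, false) : Letter d)) ++
            (μ, false) :: Letter.rev ((μ, false) : Letter d) :: (List.replicate t ((μ, true) : Letter d) ++ suf) by
          rw [List.replicate_succ' (n := t), List.replicate_succ (n := t)]; simp,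
      apply_cancel_of_length _ _ _ hA, List.append_assoc]

/-- **THE RECTANGLE SCRIPT BUILDS THE RECTANGLE WORD, LETTER FOR LETTER**: `build (rectScript κ μ K n) = κ^n μ^K κ̄^n μ̄^K`. [folklore] -/
theorem build_rectScript_replicate (κ μ : Fin d) (K : ℕ) : ∀ n : ℕ,
    build (rectScript κ μ K n) =
      List.replicate n ((κ, true) : Letter d) ++ (List.replicate K ((μ, true) : Letter d) ++
        (List.replicate n ((κ, false) : Letter d) ++ List.replicate K ((μ, false) : Letter d)))
  | 0 => by rw [rectScript, build_rowBase]; simp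
  | n + 1 => by
    have ih := build_rectScript_replicate κ μ K n
    -- (1) the backtrack at position `n`
    have h1 : build (Move.backtrack n (κ, true) :: rectScript κ μ K n) =
        List.replicate n ((κ, true) : Letter d) ++ ((κ, true) :: (κ, false) ::
          (List.replicate K ((μ, true) : Letter d) ++ (List.replicate n ((κ, false) : Letter d) ++ List.replicate K ((μ, false) : Letter d)))) := by
      rw [build, ih, apply_backtrack_of_length _ _ _ (List.length_replicate ..)]
      rfl
    -- (2) the column phase
    have h2 := build_colMoves κ μ (List.replicate n ((κ, true) : Letter d))
      (List.replicate K ((μ, true) : Letter d) ++ (List.replicate n ((κ, false) : Letter d) ++ List.replicate K ((μ, false) : Letter d)))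
      (List.length_replicate ..) _ h1 K
    -- (3) the row phase
    have h3 := build_rowCancels μ (base := n + K + 2)
      (List.replicate n ((κ, true) : Letter d) ++ ((κ, true) :: (List.replicate K ((μ, true) : Letter d) ++ [(κ, false)])))
      (List.replicate n ((κ, false) : Letter d) ++ List.replicate K ((μ, false) : Letter d)) (by simp; omega) _ K 0
      (by rw [h2, Nat.zero_add]; simp)
    rw [rectScript, h3, List.replicate_zero, List.replicate_zero, List.nil_append, List.nil_append,
      List.replicate_succ' (n := n), List.replicate_succ (n := n) (a := ((κ, false) : Letter d))]
    simp

/-- **… AND THAT WORD IS `NonAbelianStokesBound.rectWord κ μ n K`** (`seg κ n · seg μ K · (seg κ n)⁻¹ · (seg μ K)⁻¹`). [folklore] -/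
theorem build_rectScript (κ μ : Fin d) (K n : ℕ) : build (rectScript κ μ K n) = rectWord κ μ n K := by
  rw [build_rectScript_replicate, rectWord, revWord_seg, revWord_seg, seg_natCast, seg_natCast, seg_neg_natCast, seg_neg_natCast,
    List.append_assoc, List.append_assoc]

end Builds

/-! ## §3 The inserted words and where they are glued -/

section Glued

/-- `rowBase` inserts no word. -/
theorem loops_rowBase (μ : Fin d) : ∀ K : ℕ, loops (rowBase μ K) = ([] : List (List (Letter d)))
  | 0 => rfl
  | K + 1 => by rw [rowBase, loops, loops_rowBase μ K]

/-- `rowCancels` inserts no word. -/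
theorem loops_rowCancels_append (μ : Fin d) (base : ℕ) (rest : List (Move d)) :
    ∀ m t : ℕ, loops (rowCancels μ base t m ++ rest) = loops rest
  | 0, t => by rw [rowCancels, List.nil_append]
  | m + 1, t => by rw [rowCancels, List.cons_append, loops, loops_rowCancels_append μ base rest m (t + 1)]

/-- `colMoves κ μ n j` inserts `j` copies of `plaqWord κ μ`. -/
theorem loops_colMoves_append (κ μ : Fin d) (n : ℕ) (rest : List (Move d)) :
    ∀ j : ℕ, loops (colMoves κ μ n j ++ rest) = List.replicate j (plaqWord κ μ) ++ loops rest
  | 0 => by rw [colMoves, List.nil_append, List.replicate_zero, List.nil_append]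
  | j + 1 => by
    rw [colMoves, List.cons_append, List.cons_append, loops, loops, loops_colMoves_append κ μ n rest j, List.replicate_succ,
      List.cons_append]

/-- **EVERY WORD INSERTED BY THE RECTANGLE SCRIPT IS THE PLAQUETTE CONTOUR `plaqWord κ μ`** (`n·K` of them). [folklore] -/
theorem loops_rectScript (κ μ : Fin d) (K : ℕ) : ∀ n : ℕ, loops (rectScript κ μ K n) = List.replicate (n * K) (plaqWord κ μ)
  | 0 => by rw [rectScript, loops_rowBase, Nat.zero_mul, List.replicate_zero]
  | n + 1 => by
    rw [rectScript, loops_rowCancels_append, loops_colMoves_append, loops, loops_rectScript κ μ K n, ← List.replicate_add,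
      show K + n * K = (n + 1) * K by ring]

/-- Hence every inserted word is closed and is literally `plaqWord κ μ`. -/
theorem eq_plaqWord_of_mem_loops_rectScript (κ μ : Fin d) (K n : ℕ) {σ : List (Letter d)} (hσ : σ ∈ loops (rectScript κ μ K n)) :
    σ = plaqWord κ μ := by
  rw [loops_rectScript] at hσ
  exact List.eq_of_mem_replicate hσ

/-- `rowBase` glues nothing. -/
theorem glued_rowBase (μ : Fin d) (x : Site d) : ∀ K : ℕ, glued x (rowBase μ K) = []
  | 0 => rfl
  | K + 1 => by rw [rowBase, glued, glued_rowBase μ x K]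

/-- `rowCancels` glues nothing. -/
theorem glued_rowCancels_append (μ : Fin d) (x : Site d) (base : ℕ) (rest : List (Move d)) :
    ∀ m t : ℕ, glued x (rowCancels μ base t m ++ rest) = glued x rest
  | 0, t => by rw [rowCancels, List.nil_append]
  | m + 1, t => by rw [rowCancels, List.cons_append, glued, glued_rowCancels_append μ x base rest m (t + 1)]

/-- THE COLUMN PHASE GLUES ITS `j` PLAQUETTES AT THE CORNERS `x + n e_κ + i e_μ`, `i = j−1, …, 0` (newest first). [folklore] -/
theorem glued_colMoves_append (κ μ : Fin d) (x : Site d) {n : ℕ} (pre suf : List (Letter d)) (hpre : pre.length = n)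
    (hdisp : disp pre = (n : ℤ) • e κ) (rest : List (Move d)) (hrest : build rest = pre ++ ((κ, true) :: (κ, false) :: suf)) :
    ∀ j : ℕ, glued x (colMoves κ μ n j ++ rest) =
      ((List.range j).reverse.map fun i : ℕ => (x + (n : ℤ) • e κ + (i : ℤ) • e μ, plaqWord κ μ)) ++ glued x rest
  | 0 => by rw [colMoves, List.nil_append, List.range_zero, List.reverse_nil, List.map_nil, List.nil_append]
  | j + 1 => by
    have ih := glued_colMoves_append κ μ x pre suf hpre hdisp rest hrest j
    have hb := build_colMoves κ μ pre suf hpre rest hrest j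
    have hA : (pre ++ ((κ, true) :: (List.replicate j ((μ, true) : Letter d) ++ [(κ, false)]))).length = n + j + 2 := by
      simp [hpre]; omega
    have htake : (build (colMoves κ μ n j ++ rest)).take (n + j + 2) =
        pre ++ ((κ, true) :: (List.replicate j ((μ, true) : Letter d) ++ [(κ, false)])) := by
      rw [hb, show pre ++ ((κ, true) :: (List.replicate j ((μ, true) : Letter d) ++ (κ, false) :: (List.replicate j ((μ, false) : Letter d) ++ suf)))
        = (pre ++ ((κ, true) :: (List.replicate j ((μ, true) : Letter d) ++ [(κ, false)]))) ++ (List.replicate j ((μ, false) : Letter d) ++ suf) by simp]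
      exact List.take_left' hA
    have hd : disp (pre ++ ((κ, true) :: (List.replicate j ((μ, true) : Letter d) ++ [(κ, false)]))) = (n : ℤ) • e κ + (j : ℤ) • e μ := by
      simp [disp_append, hdisp]
    rw [colMoves, List.cons_append, List.cons_append, glued, glued, ih, htake, hd, List.range_succ, List.reverse_append,
      List.reverse_singleton, List.singleton_append, List.map_cons, List.cons_append, add_assoc]

/-- `glued` of the height-`0` script. -/
theorem glued_rectScript_zero (κ μ : Fin d) (x : Site d) (K : ℕ) : glued x (rectScript κ μ K 0) = [] := by
  rw [rectScript, glued_rowBase]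

/-- **THE GLUED LOOPS, ONE COLUMN AT A TIME**: passing from `n` to `n + 1` prepends the `K` plaquettes `∂p_{κμ}(x + n e_κ + j e_μ)`, `j = K−1, …, 0`. [folklore] -/
theorem glued_rectScript_succ (κ μ : Fin d) (x : Site d) (K n : ℕ) :
    glued x (rectScript κ μ K (n + 1)) =
      ((List.range K).reverse.map fun j : ℕ => (x + (n : ℤ) • e κ + (j : ℤ) • e μ, plaqWord κ μ)) ++ glued x (rectScript κ μ K n) := by
  have h1 : build (Move.backtrack n (κ, true) :: rectScript κ μ K n) =
      List.replicate n ((κ, true) : Letter d) ++ ((κ, true) :: (κ, false) ::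
        (List.replicate K ((μ, true) : Letter d) ++ (List.replicate n ((κ, false) : Letter d) ++ List.replicate K ((μ, false) : Letter d)))) := by
    rw [build, build_rectScript_replicate, apply_backtrack_of_length _ _ _ (List.length_replicate ..)]
    rfl
  rw [rectScript, glued_rowCancels_append,
    glued_colMoves_append κ μ x (List.replicate n ((κ, true) : Letter d)) _ (List.length_replicate ..)
      (by rw [disp_replicate, Letter.vec_true]) _ h1 K, glued]

/-- **SUMS OVER THE GLUED LOOPS ARE DOUBLE SUMS OVER THE PLAQUETTE CORNERS** (column index outside). [folklore] -/
theorem sum_glued_rectScript {M : Type*} [AddCommMonoid M] (κ μ : Fin d) (x : Site d) (K : ℕ)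
    (f : (Site d) × List (Letter d) → M) : ∀ n : ℕ,
    ((glued x (rectScript κ μ K n)).map f).sum =
      ∑ i ∈ Finset.range n, ∑ j ∈ Finset.range K, f (x + (i : ℤ) • e κ + (j : ℤ) • e μ, plaqWord κ μ)
  | 0 => by rw [glued_rectScript_zero, List.map_nil, List.sum_nil, Finset.sum_range_zero]
  | n + 1 => by
    have hcol : ∀ L : ℕ, (((List.range L).reverse.map fun j : ℕ => (x + (n : ℤ) • e κ + (j : ℤ) • e μ, plaqWord κ μ)).map f).sum =
        ∑ j ∈ Finset.range L, f (x + (n : ℤ) • e κ + (j : ℤ) • e μ, plaqWord κ μ) := by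
      intro L
      induction L with
      | zero => simp
      | succ L ihL =>
        rw [Finset.sum_range_succ, ← ihL, List.range_succ, List.reverse_append, List.reverse_singleton, List.singleton_append,
          List.map_cons, List.map_cons, List.sum_cons, add_comm]
    rw [glued_rectScript_succ, List.map_append, List.sum_append, sum_glued_rectScript κ μ x K f n, hcol, Finset.sum_range_succ, add_comm]

end Glued

/-! ## §4 (NAS) for the rectangle from part 3, by name -/

section NAS

variable {G : Type*} [GaugeGroup G] (V : Site d → Fin d → G)

/-- **(NAS) FOR THE RECTANGLE VIA ITS SCRIPT**: `dist1 V(∂R_{n,K}(x)) ≤ Σ_{glued loops} dist1 V(∂p)` — `NonAbelianStokesDisc.dist1_hol_build_le_sum_plaquettes`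
at `rectScript`, read through `build_rectScript`. [folklore] -/
theorem dist1_hol_rectWord_le_sum_glued (x : Site d) (κ μ : Fin d) (n K : ℕ) :
    dist1 (hol V x (rectWord κ μ n K)) ≤
      ((glued x (rectScript κ μ K n)).map fun q => dist1 (hol V q.1 (plaqWord κ μ))).sum := by
  have h := dist1_hol_build_le_sum_plaquettes V x (rectScript κ μ K n) (fun _ => (κ, μ)) (fun q hq => Or.inl ?_)
  · rwa [build_rectScript] at h
  · -- every glued word is `plaqWord κ μ`
    have hmem : q.2 ∈ loops (rectScript κ μ K n) := by
      have : ∀ ms : List (Move d), q ∈ glued x ms → q.2 ∈ loops ms := by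
        intro ms
        induction ms with
        | nil => simp [glued]
        | cons m ms ih =>
          cases m with
          | backtrack k l => simpa [glued, loops] using ih
          | cancel k l => simpa [glued, loops] using ih
          | loop k τ =>
            intro hq'
            rcases List.mem_cons.mp (by simpa [glued] using hq') with h' | h'
            · simp [loops, h']
            · simp [loops, ih h']
      exact this _ hq
    exact eq_plaqWord_of_mem_loops_rectScript κ μ K n hmem

/-- **THE COLUMN-BY-COLUMN FORM**: `dist1 V(∂R_{n,K}(x)) ≤ Σ_{i<n} Σ_{j<K} dist1 V(∂p_{κμ}(x + i e_κ + j e_μ))`. [folklore] -/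
theorem dist1_hol_rectWord_le_sum_cols (x : Site d) (κ μ : Fin d) (n K : ℕ) :
    dist1 (hol V x (rectWord κ μ n K)) ≤
      ∑ i ∈ Finset.range n, ∑ j ∈ Finset.range K, dist1 (hol V (x + (i : ℤ) • e κ + (j : ℤ) • e μ) (plaqWord κ μ)) := by
  have h := dist1_hol_rectWord_le_sum_glued V x κ μ n K
  rwa [sum_glued_rectScript κ μ x K (fun q => dist1 (hol V q.1 (plaqWord κ μ)))] at h

/-- Consistency with part 1: the row-by-row sum of `NonAbelianStokesBound.dist1_hol_rectWord_le_sum` is the same number (`Finset.sum_comm`). -/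
example (x : Site d) (κ μ : Fin d) (n K : ℕ) :
    dist1 (hol V x (rectWord κ μ n K)) ≤
      ∑ j ∈ Finset.range K, ∑ i ∈ Finset.range n, dist1 (hol V (x + (i : ℤ) • e κ + (j : ℤ) • e μ) (plaqWord κ μ)) := by
  rw [Finset.sum_comm]; exact dist1_hol_rectWord_le_sum_cols V x κ μ n K

end NAS

/-! ## §5 Sanity -/

section Sanity

/-- The script of the `2 × 1` rectangle builds leaf-01's `rectWord κ μ 2 1` (cf. the hand-made `NonAbelianStokesDisc.build_rect21`). -/
example (κ μ : Fin d) : build (rectScript κ μ 1 2) = rectWord κ μ 2 1 := build_rectScript κ μ 1 2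

/-- The `1 × 1` script builds the plaquette word itself. -/
example (κ μ : Fin d) : build (rectScript κ μ 1 1) = plaqWord κ μ := by
  rw [build_rectScript]; rfl

/-- … and glues exactly one plaquette, at `x`. -/
example (κ μ : Fin d) (x : Site d) : glued x (rectScript κ μ 1 1) = [(x + (0 : ℤ) • e κ + (0 : ℤ) • e μ, plaqWord κ μ)] := by
  rw [glued_rectScript_succ, glued_rectScript_zero]; simp

end Sanity

end Summit.QuantumFields.BalabanUV.T4Continuum.NE7b.NonAbelianStokesRectScript
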